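import Literature.AlgebraicTopology.FundamentalGroup.RotationGroupSO3
import HarnessLib

/-!
# Crux `NonSimplyConnectedLatticeGap` (stmt-QuantumFields-16405), route `ConvexGribovBody`, line `Sketch` —
# stub `stub_so3_compactConnectedGroup` (I1: `SO(3)` is a compact, connected, non-abelian topological group)

Skeleton line `Sketch` v3 of the crux
`Summit.QuantumFields.YangMills.Theses.ConvexGribovBody.NonSimplyConnectedLatticeGap` certifies the first
admissible instance `G = SO(3)` of the crux's hypothesis class (compact simple gauge groups with `π₁(G) ≠ 0`).
This file proves the registered side-stub I1 about the tree's rotation group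
`Literature.AlgebraicTopology.FundamentalGroup.SO3 = {M ∈ M₃(ℝ) | Mᵀ M = 1, det M = 1}` (subspace topology,
its own `Group` instance):

1. `IsTopologicalGroup SO3` — matrix multiplication and transpose (= inverse on `SO(3)`) are continuous on
   `M₃(ℝ)`, hence on the subtype;
2. `CompactSpace SO3` and
3. `ConnectedSpace SO3` — `SO(3)` is the image of the compact connected unit sphere `S³ ⊂ ℍ` under the
   tree's continuous surjective covering homomorphism `rotHom : S³ →* SO(3)` (`continuous_rotHom`,
   `surjective_rotHom`);
4. non-commutativity — the quarter turns about the first and third coordinate axes (`rotX 0 1`, `rotZ 0 1`,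
   both in the range of `rotHom` by `rotX_mem_range` / `rotZ_mem_range`) do not commute: the `(0,1)` entries
   of the two products are `-1` and `0`.

Helper lemmas are prefixed `so3_`. No named unproved facts are used.
-/

set_option autoImplicit false

noncomputable section

namespace Summit.QuantumFields.YangMills.Theorems.NonSimplyConnectedLatticeGap

open Literature.AlgebraicTopology.FundamentalGroup

/-- **`SO(3)` is a topological group**: multiplication is the restriction of the (continuous) matrix
product of the topological ring `M₃(ℝ)`, inversion is the restriction of the (continuous) transpose. [folklore] -/
theorem so3_isTopologicalGroup : IsTopologicalGroup SO3 where
  continuous_mul := continuous_induced_rng.2 <| by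
    show Continuous fun p : SO3 × SO3 => (p.1 * p.2).1
    simp only [SO3.coe_mul]
    exact (continuous_subtype_val.comp continuous_fst).mul (continuous_subtype_val.comp continuous_snd)
  continuous_inv := continuous_induced_rng.2 <| by
    show Continuous fun A : SO3 => (A⁻¹).1
    simp only [SO3.coe_inv]
    exact continuous_subtype_val.matrix_transpose

/-- **`SO(3)` is compact**: it is the continuous image of the compact `S³` under `rotHom`. [folklore] -/
theorem so3_compactSpace : CompactSpace SO3 :=
  surjective_rotHom.compactSpace continuous_rotHom

/-- **`SO(3)` is connected**: it is the continuous image of the connected `S³` under `rotHom`. [folklore] -/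
theorem so3_connectedSpace : ConnectedSpace SO3 :=
  surjective_rotHom.connectedSpace continuous_rotHom

/-- **`SO(3)` is not commutative**: the quarter turns about the first and the third coordinate axes do not
commute (compare the `(0,1)` entries of the two products). [folklore] -/
theorem so3_exists_mul_ne : ∃ a b : SO3, a * b ≠ b * a := by
  obtain ⟨p, hp⟩ := rotX_mem_range 0 1 (by norm_num)
  obtain ⟨q, hq⟩ := rotZ_mem_range 0 1 (by norm_num)
  refine ⟨rotHom p, rotHom q, fun h => ?_⟩
  have h' := congrFun (congrFun (congrArg Subtype.val h) 0) 1
  simp only [SO3.coe_mul, hp, hq] at h'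
  simp [rotX, rotZ, Matrix.mul_apply, Fin.sum_univ_three] at h'

/-- **STUB I1 — `SO(3)` is a compact, connected, non-abelian topological group** (matrix multiplication and
transpose are continuous on the subtype; `SO3 = rotHom '' S³` is compact and connected as the continuous image
of the compact connected `S³`; two coordinate-axis quarter turns do not commute). [folklore] -/
theorem stub_so3_compactConnectedGroup :
    IsTopologicalGroup Literature.AlgebraicTopology.FundamentalGroup.SO3 ∧
    CompactSpace Literature.AlgebraicTopology.FundamentalGroup.SO3 ∧
    ConnectedSpace Literature.AlgebraicTopology.FundamentalGroup.SO3 ∧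
    ∃ a b : Literature.AlgebraicTopology.FundamentalGroup.SO3, a * b ≠ b * a :=
  ⟨so3_isTopologicalGroup, so3_compactSpace, so3_connectedSpace, so3_exists_mul_ne⟩

end Summit.QuantumFields.YangMills.Theorems.NonSimplyConnectedLatticeGap

end
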